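import Literature.Analysis.FluidPDE.PalasekObukhov.ShellEmbedding

/-!
# Palasek 2026, §2 (2.7): the discrete scaling symmetry of the geometric `L^∞` Obukhov model

S. Palasek, *Finite-time blow-up in an elementary model of the 3D Navier–Stokes equations*,
arXiv:2605.13827 (2026) [Palasek2026ElementaryModel], §2 p. 7, after the energy identity (2.6):

> "When `N_k = λ^k` for some `λ > 1` and `k` runs over `ℤ`, there is a discrete group of scaling
> symmetries `Y_k(t) ↦ λ^n Y_{k-n}(λ^{2n}t)`, `n ∈ ℤ` (2.7), corresponding to a discrete subgroup of
> the usual scaling symmetries for the Navier–Stokes equations on `ℝ³`."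

This file types exactly that, statements first and everything proved, for the `L^∞`-based model
(linfty_obukhov) of §2 (`linftyRHS`, file `ShellEmbedding.lean`) on the TWO-SIDED geometric lattice of
scales `N_k = λ^k`, `k ∈ ℤ`:

* `linftyRHSZ ν α λ Y k` — the right-hand side of (linfty_obukhov) at mode `k ∈ ℤ` for `N_k = λ^k`
  (so `(N_k/N_{k+1})^{2(α-1)} = λ^{-2(α-1)}`), unforced; `linftyRHSZ_eq_linftyRHS` — on the modes `k ≥ 1`
  it IS the `ℕ`-indexed `linftyRHS` of `ShellEmbedding.lean` with `N_k = λ^k` and zero force.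
* `rescale λ n Y` — the map (2.7), `(rescale λ n Y)_k(t) = λ^n Y_{k-n}(λ^{2n}t)`.
* `linftyRHSZ_rescale` — the algebraic identity behind the symmetry: the right-hand side evaluated at
  the rescaled amplitudes is `λ^{3n}` times the right-hand side at the original ones, mode `k - n` —
  with the SAME viscosity `ν` (as for `u ↦ λu(λx, λ²t)` in Navier–Stokes);
  `hasDerivAt_rescale` — hence (2.7) maps solutions to solutions: if every `Y_j` has derivative
  (linfty_obukhov) at the time `λ^{2n}t`, then every `(rescale λ n Y)_k` has derivative
  (linfty_obukhov) at `t`; `rescale_zero` / `rescale_add` — it is a `ℤ`-action (a "discrete group").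

WHAT THIS IS NOT. Not Navier–Stokes. The symmetry is a property of the GEOMETRIC lattice `N_k = λ^k`
only; Palasek's blow-up uses the super-lacunary scales `N_k = N₀^{b^k}` of (nk_choice), which admit no
such symmetry (the ratio `N_{k+1}/N_k = N_k^{b-1}` is not constant) — the source records (2.7) among
the "parallels [that] motivate the use of the model", not as an ingredient of the proof. No named
facts; the two definitions have bodies.
-/

open Set Filter

noncomputable section

namespace Literature.Analysis.FluidPDE

namespace PalasekObukhov

variable {ν α lam : ℝ}

/-- **The `ℤ`-indexed `L^∞` Obukhov model on the geometric lattice `N_k = λ^k`, unforced**: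
`Y_k' = -νλ^{2k}Y_k + λ^{k-1}Y_{k-1}Y_k - λ^{-2(α-1)}λ^kY_{k+1}²`, `k ∈ ℤ` — (linfty_obukhov) with
`N_k = λ^k`, `(N_k/N_{k+1})^{2(α-1)} = λ^{-2(α-1)}`, `h_k = 0`, and `k` running over `ℤ` (no lowest mode).
[cite: Palasek2026ElementaryModel, §2 (linfty_obukhov) and (2.7), p. 7] -/
def linftyRHSZ (ν α lam : ℝ) (Y : ℤ → ℝ) (k : ℤ) : ℝ :=
  -ν * (lam ^ k) ^ 2 * Y k + lam ^ (k - 1) * Y (k - 1) * Y k -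
    lam ^ (-(2 * (α - 1))) * lam ^ k * Y (k + 1) ^ 2

/-- On the modes `k ≥ 1` the `ℤ`-indexed right-hand side is the `ℕ`-indexed (linfty_obukhov) of §2
(`linftyRHS`) for the scales `N_k = λ^k` and zero force (at `k = 0` the `ℕ`-indexed model has no input
term, `Y_{-1} ≡ 0`, while the two-sided lattice has the mode `-1`). [cite: Palasek2026ElementaryModel, §2 (linfty_obukhov), (2.7)] -/
theorem linftyRHSZ_eq_linftyRHS (hlam : 0 < lam) (ν α : ℝ) (Y : ℤ → ℝ) {k : ℕ} (hk : 1 ≤ k) :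
    linftyRHSZ ν α lam Y k =
      linftyRHS ν α (fun j => lam ^ j) (fun j => Y j) 0 k := by
  have hk0 : k ≠ 0 := by omega
  have hlam0 : lam ≠ 0 := hlam.ne'
  have hratio : (lam ^ k / lam ^ (k + 1)) ^ (2 * (α - 1)) = lam ^ (-(2 * (α - 1))) := by
    rw [pow_succ, div_mul_eq_div_div, div_self (pow_ne_zero _ hlam0), one_div,
      Real.inv_rpow hlam.le, Real.rpow_neg hlam.le]
  have hcast1 : ((k : ℤ) - 1) = ((k - 1 : ℕ) : ℤ) := by omega
  simp only [linftyRHSZ, linftyRHS, hk0, ↓reduceIte, add_zero, hratio, zpow_natCast, hcast1]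
  push_cast
  ring

/-- **The scaling map (2.7)**: `(rescale λ n Y)_k(t) = λ^n Y_{k-n}(λ^{2n}t)`, `n ∈ ℤ`, on time-dependent
two-sided amplitude vectors `Y k t`. [cite: Palasek2026ElementaryModel, §2 (2.7), p. 7] -/
def rescale (lam : ℝ) (n : ℤ) (Y : ℤ → ℝ → ℝ) (k : ℤ) (t : ℝ) : ℝ :=
  lam ^ n * Y (k - n) ((lam ^ n) ^ 2 * t)

/-- `n = 0` is the identity. [cite: Palasek2026ElementaryModel, §2 (2.7)] -/
@[simp] theorem rescale_zero (lam : ℝ) (Y : ℤ → ℝ → ℝ) : rescale lam 0 Y = Y := by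
  funext k t
  simp [rescale]

/-- **(2.7) is a `ℤ`-action ("a discrete group of scaling symmetries")**: rescaling by `m` and then by
`n` is rescaling by `n + m` (`λ ≠ 0`). [cite: Palasek2026ElementaryModel, §2 (2.7), p. 7] -/
theorem rescale_add (hlam : lam ≠ 0) (n m : ℤ) (Y : ℤ → ℝ → ℝ) :
    rescale lam n (rescale lam m Y) = rescale lam (n + m) Y := by
  funext k t
  simp only [rescale]
  rw [zpow_add₀ hlam, show k - (n + m) = k - n - m by ring,
    show (lam ^ n * lam ^ m) ^ 2 * t = (lam ^ m) ^ 2 * ((lam ^ n) ^ 2 * t) by ring]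
  ring

/-- **The algebra of the symmetry**: at the rescaled amplitudes `Ỹ_j = λ^nY_{j-n}` the right-hand side
of mode `k` is `λ^{3n} = λ^n·(λ^n)²` times the right-hand side of mode `k - n` at `Y` — term by term:
viscous `λ^{3n}λ^{2(k-n)} = λ^{2k}λ^n`, pump `λ^{3n}λ^{k-n-1} = λ^{k-1}λ^{2n}`, back-reaction
`λ^{3n}λ^{k-n} = λ^kλ^{2n}`; the viscosity is UNCHANGED. [cite: Palasek2026ElementaryModel, §2 (2.7), p. 7] -/
theorem linftyRHSZ_rescale (hlam : lam ≠ 0) (ν α : ℝ) (n : ℤ) (Y : ℤ → ℝ) (k : ℤ) :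
    linftyRHSZ ν α lam (fun j => lam ^ n * Y (j - n)) k =
      lam ^ n * ((lam ^ n) ^ 2 * linftyRHSZ ν α lam Y (k - n)) := by
  have h1 : lam ^ (k - n) = lam ^ k * (lam ^ n)⁻¹ := by
    rw [zpow_sub₀ hlam, div_eq_mul_inv]
  have h2 : lam ^ (k - n - 1) = lam ^ k * (lam ^ n)⁻¹ * lam⁻¹ := by
    rw [zpow_sub₀ hlam, zpow_sub₀ hlam, zpow_one, div_eq_mul_inv, div_eq_mul_inv]
  have h3 : lam ^ (k - 1) = lam ^ k * lam⁻¹ := by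
    rw [zpow_sub₀ hlam, zpow_one, div_eq_mul_inv]
  have h4 : k - 1 - n = k - n - 1 := by ring
  have h5 : k + 1 - n = k - n + 1 := by ring
  have hn : lam ^ n ≠ 0 := zpow_ne_zero n hlam
  simp only [linftyRHSZ, h4, h5, h1, h2, h3]
  field_simp

/-- **(2.7) maps solutions to solutions (the discrete scaling symmetry).** If at the time `λ^{2n}t` every
mode `Y_j` has derivative (linfty_obukhov) (`N_k = λ^k`, `k ∈ ℤ`, viscosity `ν`, no force), then at the
time `t` every mode of `Ỹ = rescale λ n Y`, `Ỹ_k(t) = λ^nY_{k-n}(λ^{2n}t)`, has derivative (linfty_obukhov)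
with the SAME `ν` — "corresponding to a discrete subgroup of the usual scaling symmetries for the
Navier–Stokes equations on `ℝ³`" (`u ↦ λ^n u(λ^n x, λ^{2n}t)` maps the shell `k - n` to the shell `k`).
[cite: Palasek2026ElementaryModel, §2 (2.7), p. 7] -/
theorem hasDerivAt_rescale (hlam : lam ≠ 0) (ν α : ℝ) (n : ℤ) {Y : ℤ → ℝ → ℝ} {t : ℝ}
    (hY : ∀ j, HasDerivAt (Y j)
      (linftyRHSZ ν α lam (fun i => Y i ((lam ^ n) ^ 2 * t)) j) ((lam ^ n) ^ 2 * t))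
    (k : ℤ) :
    HasDerivAt (rescale lam n Y k)
      (linftyRHSZ ν α lam (fun i => rescale lam n Y i t) k) t := by
  have hc : HasDerivAt (fun s : ℝ => (lam ^ n) ^ 2 * s) ((lam ^ n) ^ 2 * 1) t :=
    (hasDerivAt_id t).const_mul _
  have h1 : HasDerivAt (fun s => Y (k - n) ((lam ^ n) ^ 2 * s))
      (linftyRHSZ ν α lam (fun i => Y i ((lam ^ n) ^ 2 * t)) (k - n) * ((lam ^ n) ^ 2 * 1)) t :=
    (hY (k - n)).comp t hc
  have h2 : HasDerivAt (fun s => lam ^ n * Y (k - n) ((lam ^ n) ^ 2 * s))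
      (lam ^ n * (linftyRHSZ ν α lam (fun i => Y i ((lam ^ n) ^ 2 * t)) (k - n) *
        ((lam ^ n) ^ 2 * 1))) t :=
    h1.const_mul _
  have hfun : rescale lam n Y k = fun s => lam ^ n * Y (k - n) ((lam ^ n) ^ 2 * s) := rfl
  rw [hfun]
  refine h2.congr_deriv ?_
  have hresc : (fun i => rescale lam n Y i t) = fun i => lam ^ n * Y (i - n) ((lam ^ n) ^ 2 * t) := rfl
  rw [hresc, linftyRHSZ_rescale hlam ν α n (fun i => Y i ((lam ^ n) ^ 2 * t)) k]
  ring

end PalasekObukhov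

end Literature.Analysis.FluidPDE

end
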